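import Summits.CriticalPhenomena.SAWScalingLimit.Theorems.SAWLeftRightFKGFKGToTraversalBoundSplitWild
import Summits.CriticalPhenomena.SAWScalingLimit.Theorems.SAWLeftRightFKGFKGToTraversalBoundGermTightShallow
import Summits.CriticalPhenomena.SAWScalingLimit.Theorems.SAWLeftRightFKGFKGToTraversalBoundTameRect
import HarnessLib

/-!
# Where the crux is closed modulo the engine and the bubble: tame domains × shallow approximations

Crux `SAWLeftRightFKG.FKGToTraversalBound` (stmt-CriticalPhenomena-1878), line `slit-necklace`, lead c6.  The line's skeleton
(`Cruxes/FKGToTraversalBound/Lines/slit_necklace.lean`) has four open stubs, all crux-sized: the ENGINE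
(`LeftRightFKG → CriticalBubbleBound → UniformSubshellTight`), the critical BUBBLE (stmt-CriticalPhenomena-7117), GERM tightness
at both marked points, and the WILD-domain residue of the necklace reduction.  This file records, as kernel-checked glue over
landed theorems, the class of instances `(D; a, b)` on which the last two are ALREADY DISCHARGED — so that there (H1) for the
critical SAW follows from PA + bubble + engine alone:

* the domain is EVENTUALLY TAME (`EventuallyTame D`; certified so far: every axis-parallel open rectangle,
  `eventuallyTame_of_carrier_eq_rect` p165207, at every mesh with no defect), and
* the endpoint approximation is SHALLOW — both lattice endpoints stay within `K` meshes of `ℂ ∖ D`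
  (`germTight_pair_of_shallow`, p162425; this contains the R1 class `Negative.BdryApprox` of lattice-boundary endpoints,
  `germTight_of_bdryApprox` p128312, and Duminil-Copin–Smirnov's "closest vertex" convention whenever the closest vertex is
  `O(δ)`-deep).

`h1At_of_eventuallyTame_of_shallow` is the registered glue; `h1At_rect_of_shallow` its rectangle instance.  No `sorry`, no
definition, no named literature fact.
-/

noncomputable section

open MeasureTheory Filter Topology Set Metric
open scoped NNReal ENNReal
open Literature.Probability.LatticeModels
open Literature.Probability.RandomPlanarGeometry
open Literature.Probability.RandomPlanarGeometry.SAW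
open Summit.CriticalPhenomena.SAWScalingLimit.Theses.SAWLeftRightFKG
open Summit.CriticalPhenomena.SAWScalingLimit.Theses.SAWTotalPositivity (CriticalBubbleBound)
open Summit.CriticalPhenomena.SAWScalingLimit.Theorems.FKGToTraversalBound.Negative (dom H1At BdryApprox)
open Summit.CriticalPhenomena.SAWScalingLimit.Theorems.FKGToTraversalBound.SlitNecklace

namespace Summit.CriticalPhenomena.SAWScalingLimit.Theorems.FKGToTraversalBound.Split

/-- **Registered glue `h1At_of_eventuallyTame_of_shallow`.**  Given the critical bubble, the engine and left–right PA, the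
Aizenman–Burchard hypothesis (H1) (`Negative.H1At`, definitionally the body of `SAWTraversalBound` at one approximation) holds for
every endpoint approximation of an EVENTUALLY TAME Dobrushin domain whose two lattice endpoints are SHALLOW (depth `≤ K δ`
eventually): germ tightness is `germTight_pair_of_shallow`, per-shell eventual tightness is the landed tame necklace reduction
`necklaceReduction_tame`, and `stub_eventualShellReduction` assembles (H1). [folklore] -/
theorem h1At_of_eventuallyTame_of_shallow :
    CriticalBubbleBound → (LeftRightFKG → CriticalBubbleBound → UniformSubshellTight) → LeftRightFKG →
      ∀ (D : DobrushinDomain) (a b : ℝ → Site 2) (K : ℝ), IsEndpointApprox D a b → EventuallyTame D →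
        (∀ᶠ δ in 𝓝[>] (0 : ℝ), infDist (meshPoint δ (a δ)) D.carrierᶜ ≤ K * δ ∧
          infDist (meshPoint δ (b δ)) D.carrierᶜ ≤ K * δ) →
        H1At D a b := by
  intro hB hE hPA D a b K hab hD hsh
  have hG := germTight_pair_of_shallow D a b K hsh
  exact stub_eventualShellReduction D a b hab (necklaceReduction_tame (hE hPA hB) D a b hab hD hG.1 hG.2)

/-- **Rectangle instance.**  On an axis-parallel open rectangle (eventually tame by `eventuallyTame_of_carrier_eq_rect`) with a
shallow endpoint approximation, (H1) follows from bubble + engine + PA. [folklore] -/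
theorem h1At_rect_of_shallow (hB : CriticalBubbleBound) (hE : LeftRightFKG → CriticalBubbleBound → UniformSubshellTight)
    (hPA : LeftRightFKG) (D : DobrushinDomain) (p q r s : ℝ)
    (hD : D.carrier = {z : ℂ | p < z.re ∧ z.re < q ∧ r < z.im ∧ z.im < s}) (a b : ℝ → Site 2) (K : ℝ)
    (hab : IsEndpointApprox D a b)
    (hsh : ∀ᶠ δ in 𝓝[>] (0 : ℝ), infDist (meshPoint δ (a δ)) D.carrierᶜ ≤ K * δ ∧
      infDist (meshPoint δ (b δ)) D.carrierᶜ ≤ K * δ) :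
    H1At D a b :=
  h1At_of_eventuallyTame_of_shallow hB hE hPA D a b K hab (eventuallyTame_of_carrier_eq_rect D p q r s hD) hsh

/-- The rectangle instance class is inhabited at the level of domains: for every non-degenerate rectangle there is a Dobrushin
domain with that carrier, and it is eventually tame (`exists_dobrushinDomain_rect_eventuallyTame`, p165207). [folklore] -/
example : ∃ D : DobrushinDomain, D.carrier = {z : ℂ | (0 : ℝ) < z.re ∧ z.re < 1 ∧ (0 : ℝ) < z.im ∧ z.im < 1} ∧
    EventuallyTame D :=
  exists_dobrushinDomain_rect_eventuallyTame 0 1 0 1 one_pos one_pos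

end Summit.CriticalPhenomena.SAWScalingLimit.Theorems.FKGToTraversalBound.Split

end
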